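import Literature.Computability.AlgebraicComplexity.WeightedEntropyMax
import Mathlib.Analysis.SpecialFunctions.Log.Base
import HarnessLib

/-!
# Break-even certificates for the single-level laser method: a kernel-checkable dual witness that a block structure cannot prove `ω < ρ`

Topic `Literature/Computability/AlgebraicComplexity`; a client of Gibbs' inequality in its weighted
three-marginal form `weightedEntropy_le_sum_mul_score` (`WeightedEntropyMax.lean`) and a companion of
`LaserMethodTheorem.lean` (BCS Thm. (15.41)).

The object.  A *level-1 laser structure* is the combinatorial datum the laser method of
Strassen / Coppersmith–Winograd (BCS 1997, Thm. (15.41)) is run on: a block support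
`S ⊆ [n_a] × [n_b] × [n_c]` (the `D`-support of a tensor `t` for a direct-sum decomposition `D` of its
three factors), for each `s ∈ S` the volume `vol(s) = e h l ≥ 1` of the matrix tensor `⟨e,h,l⟩` the
`D`-component `t_s` is isomorphic to, and a cost `r` (the border rank `R̲(t)`, or a certified lower
bound for it).  With `P` ranging over probability distributions on `S` and `P₁, P₂, P₃` its marginals,
Thm. (15.41) reads `min_m H(P_m) + (ω/3) ∑_s P(s) log₂ vol(s) ≤ log₂ R̲(t)`, and applied to the
`ℤ₃`-symmetrisation `t ⊗ σt ⊗ σ²t` (block support `S × σS × σ²S`, product distributions) it gives the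
form in which it is always used,
`F_ω(P) := (H(P₁)+H(P₂)+H(P₃))/3 + (ω/3) ∑_s P(s) log₂ vol(s) ≤ log₂ R̲(t)`   (BCS (15.41)–(15.43);
CW 1990, §6).  Hence the structure *proves* `ω ≤ ρ` exactly when `max_P F_ρ(P) ≥ log₂ r`, and it
**cannot prove any bound below `ρ`** when

  `CannotBeat ρ :  ∀ P ∈ P(S),  F_ρ(P) ≤ log₂ r`.

The certificate.  `F_ρ` is concave; by Gibbs' inequality `H(P_m) ≤ ∑_x P_m(x) log₂(1/Q_m(x))` for any
sub-probability vector `Q_m` positive on the projection of `supp P`, so `CannotBeat ρ` follows from the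
POINTWISE inequalities `(1/3) ∑_m log₂(1/Q_m(s_m)) + (ρ/3) log₂ vol(s) ≤ log₂ r` for all `s ∈ S`
(LP duality; the optimal `Q_m` are the marginals of the maximiser).  With `ρ = cn/cd` and
`Q_m = u_m/U_m` INTEGER vectors this is the closed integer inequality

  `vol(s)^cn · (U_a U_b U_c)^cd ≤ r^(3·cd) · (u_a(s₁) u_b(s₂) u_c(s₃))^cd`     (`LaserCert.pointCheck`),

decided by `Nat.pow`/`Nat.ble` in the kernel.  `LaserCert.check` conjoins these with
`∑ u_m ≤ U_m`, positivity and `r, vol ≥ 1`; `cannotBeat_of_check` is the soundness theorem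
(`check cn cd = true → ρ ≤ cn/cd → CannotBeat ρ`; monotone in `ρ` because `log₂ vol ≥ 0`).
Corollaries: the `min`-form of (15.41) (`CannotBeat.min_form`) and the reading "every bound
`ω ≤ 3 (log₂ R − H̄(P)) / E_P log₂ vol` the structure yields at any cost `R ≥ r` is `≥ ρ`"
(`CannotBeat.le_extracted_bound`).

Instances (pub-tensor bundle `papers/MatrixMultiplication/small-tensor-tables`, VALUE.md §3–§4; duals
found in floating point by `numerics/gen9/breakeven24.py` and rounded to denominators `U ≤ 14`; only the
kernel check is trusted): this file carries the big Coppersmith–Winograd tensor `CW_3` (`q = 3`,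
`r = R̲ = 5`, unique admissible structure, value `2.4739…`) as the worked example
(`cannotBeat_CW3 : ρ ≤ 12/5 → cert_CW3.CannotBeat ρ`); the companion files
`LaserBreakEvenSmallFormats.lean` (all 48 admissible structures of the named formats of side `≤ 5`)
and `LaserBreakEvenCensusPart1.lean` / `LaserBreakEvenCensusPart2.lean` (the 13 + 300 structures of
the cyclic support censuses `K = 3, 4`) are tables of such certificates, each closed by one
`decide +kernel`.

HONEST FRAMING (bundle VALUE.md §1–§2).  These are certified table entries / decidable verdicts —
barrier bookkeeping for ONE method (single-level laser, symmetrised (15.41)) on toy structures, NOT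
summit progress on `ω` and not a lower bound on `ω` (`P(ω ≤ 2.3 this quarter) < 1 %`).  The exponent
`12/5 = 2.4` is a round threshold above Coppersmith–Winograd's level-1 value `2.3871900` and below every
value in the bundle's tables (minimum `2.4601…`); nothing here speaks to higher laser levels or other
methods (Ambainis–Filmus–Le Gall 2015 is the relevant barrier literature for those).

## References

* P. Bürgisser, M. Clausen, M. A. Shokrollahi, *Algebraic Complexity Theory*, Springer 1997,
  Thm. (15.41), (15.43), pp. 380–383. [BurgisserClausenShokrollahi1997]
* D. Coppersmith, S. Winograd, *Matrix multiplication via arithmetic progressions*,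
  J. Symb. Comput. 9 (1990), §6. [CoppersmithWinograd1990]
* V. Strassen, *Relative bilinear complexity and matrix multiplication*, J. reine angew. Math. 375/376
  (1987). [Strassen1987]
* A. Ambainis, Y. Filmus, F. Le Gall, *Fast matrix multiplication: limitations of the
  Coppersmith–Winograd method*, STOC 2015. [AmbainisFilmusLeGall2015]
-/

open scoped BigOperators

namespace Literature.Computability.AlgebraicComplexity

/-! ## The certificate data and its Boolean check -/

/-- **Level-1 laser structure with an integer dual certificate.**  `na, nb, nc`: numbers of blocks in the
three factors; `pts`: the block support with volumes, entries `(i, j, l, vol)` meaning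
`s = (i,j,l) ∈ S` and `t_s ≅ ⟨e,h,l⟩` with `e h l = vol`; `r`: the cost (border rank or a lower bound for
it); `qa, qb, qc / Qa, Qb, Qc`: numerators / denominators of the three dual sub-probability vectors
`Q_m = q_m / Q_m`. [cite: BurgisserClausenShokrollahi1997, Thm. 15.41 (p. 380)] -/
structure LaserCert where
  /-- number of blocks of the first factor -/
  na : ℕ
  /-- number of blocks of the second factor -/
  nb : ℕ
  /-- number of blocks of the third factor -/
  nc : ℕ
  /-- block support with volumes: `(i, j, l, e*h*l)` -/
  pts : List (ℕ × ℕ × ℕ × ℕ)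
  /-- cost: border rank (or a certified lower bound) -/
  r : ℕ
  /-- dual numerators, first factor -/
  qa : List ℕ
  /-- dual numerators, second factor -/
  qb : List ℕ
  /-- dual numerators, third factor -/
  qc : List ℕ
  /-- dual denominator, first factor -/
  Qa : ℕ
  /-- dual denominator, second factor -/
  Qb : ℕ
  /-- dual denominator, third factor -/
  Qc : ℕ

namespace LaserCert

variable (C : LaserCert)

/-- `∑_{a < n} f a` by structural recursion (kernel-friendly). [folklore] -/
def sumBelow (f : ℕ → ℕ) : ℕ → ℕ
  | 0 => 0
  | n + 1 => sumBelow f n + f n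

/-- `sumBelow f n = ∑_{a : Fin n} f a`. [folklore] -/
theorem sumBelow_eq (f : ℕ → ℕ) (n : ℕ) : sumBelow f n = ∑ a : Fin n, f a := by
  induction n with
  | zero => simp [sumBelow]
  | succ n ih => rw [Fin.sum_univ_castSucc, sumBelow, ih]; simp

/-- The per-block-point check at exponent `ρ = cn/cd`: `vol ≥ 1`, the three dual numerators at the
point are positive, and `vol^cn · (Qa Qb Qc)^cd ≤ r^(3 cd) · (qa_i qb_j qc_l)^cd` — the exponentiated
form of `(1/3) ∑_m log₂ (Q_m/q_m(s_m)) + (ρ/3) log₂ vol(s) ≤ log₂ r`. [cite: BurgisserClausenShokrollahi1997, Thm. 15.41 (p. 380)] -/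
def pointCheck (cn cd : ℕ) (p : ℕ × ℕ × ℕ × ℕ) : Bool :=
  decide (1 ≤ p.2.2.2) && decide (0 < C.qa.getD p.1 0) && decide (0 < C.qb.getD p.2.1 0) &&
    decide (0 < C.qc.getD p.2.2.1 0) &&
    decide (p.2.2.2 ^ cn * (C.Qa * C.Qb * C.Qc) ^ cd ≤
      C.r ^ (3 * cd) * (C.qa.getD p.1 0 * C.qb.getD p.2.1 0 * C.qc.getD p.2.2.1 0) ^ cd)

/-- The whole certificate check at exponent `ρ = cn/cd`: `cd > 0`, `r ≥ 1`, positive denominators,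
`∑ q_m ≤ Q_m` (sub-probability duals) and `pointCheck` at every listed block point.
[cite: BurgisserClausenShokrollahi1997, Thm. 15.41 (p. 380)] -/
def check (cn cd : ℕ) : Bool :=
  decide (0 < cd) && decide (1 ≤ C.r) && decide (0 < C.Qa) && decide (0 < C.Qb) && decide (0 < C.Qc) &&
    decide (sumBelow (fun a => C.qa.getD a 0) C.na ≤ C.Qa) &&
    decide (sumBelow (fun b => C.qb.getD b 0) C.nb ≤ C.Qb) &&
    decide (sumBelow (fun c => C.qc.getD c 0) C.nc ≤ C.Qc) &&
    C.pts.all (C.pointCheck cn cd)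

/-! ## The objects the certificate speaks about -/

/-- The block index box `[na] × [nb] × [nc]`. [folklore] -/
abbrev Idx : Type := Fin C.na × Fin C.nb × Fin C.nc

/-- Coordinates of a block index as naturals. [folklore] -/
def key (y : C.Idx) : ℕ × ℕ × ℕ := (y.1.val, y.2.1.val, y.2.2.val)

/-- Coordinates of a listed block point (forgetting the volume). [folklore] -/
def ptKey (p : ℕ × ℕ × ℕ × ℕ) : ℕ × ℕ × ℕ := (p.1, p.2.1, p.2.2.1)

/-- The block support `S ⊆ [na] × [nb] × [nc]` of the structure. [cite: BurgisserClausenShokrollahi1997, Thm. 15.41 (p. 380)] -/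
def support : Set C.Idx := {y | ∃ p ∈ C.pts, ptKey p = C.key y}

/-- The volume `e h l` of the matrix component at a block index (`0` off the listed points).
[cite: BurgisserClausenShokrollahi1997, Thm. 15.41 (p. 380)] -/
def vol (y : C.Idx) : ℕ :=
  match C.pts.find? (fun p => decide (ptKey p = C.key y)) with
  | some p => p.2.2.2
  | none => 0

/-- **The symmetrised single-level laser functional** at exponent `ρ`:
`F_ρ(P) = (H(P₁)+H(P₂)+H(P₃))/3 + (ρ/3) ∑_s P(s) log₂ vol(s)` (BCS (15.41) applied to `t ⊗ σt ⊗ σ²t`;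
CW 1990, §6). [cite: BurgisserClausenShokrollahi1997, Thm. 15.41 and (15.43) (pp. 380–383)] -/
noncomputable def laserFunctional (ρ : ℝ) (P : C.Idx → ℝ) : ℝ :=
  (shannonEntropy (marginalDist₁ P) + shannonEntropy (marginalDist₂ P) +
      shannonEntropy (marginalDist₃ P)) / 3 +
    ρ * (∑ y, P y * Real.logb 2 (C.vol y : ℝ)) / 3

/-- **The structure cannot prove `ω < ρ` by the (symmetrised, single-level) laser method at cost `r`:**
`F_ρ(P) ≤ log₂ r` for every probability distribution `P` supported in `S`.
[cite: BurgisserClausenShokrollahi1997, Thm. 15.41 (p. 380)] -/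
def CannotBeat (ρ : ℝ) : Prop :=
  ∀ P : C.Idx → ℝ, (∀ y, 0 ≤ P y) → ∑ y, P y = 1 → (∀ y, y ∉ C.support → P y = 0) →
    C.laserFunctional ρ P ≤ Real.logb 2 (C.r : ℝ)

/-! ## Soundness -/

/-- The pointwise dual inequality in logarithmic form, from its exponentiated integer form.
[folklore] -/
theorem point_ineq {cn cd r v Ua Ub Uc a b c : ℕ} (hcd : 0 < cd) (hr : 1 ≤ r) (hv : 1 ≤ v)
    (hUa : 0 < Ua) (hUb : 0 < Ub) (hUc : 0 < Uc) (ha : 0 < a) (hb : 0 < b) (hc : 0 < c)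
    (h : v ^ cn * (Ua * Ub * Uc) ^ cd ≤ r ^ (3 * cd) * (a * b * c) ^ cd) :
    (1 / 3 : ℝ) * (-Real.log ((a : ℝ) / Ua) / Real.log 2) +
          1 / 3 * (-Real.log ((b : ℝ) / Ub) / Real.log 2) +
          1 / 3 * (-Real.log ((c : ℝ) / Uc) / Real.log 2) +
        (cn : ℝ) / cd * Real.logb 2 (v : ℝ) / 3 ≤ Real.logb 2 (r : ℝ) := by
  have hr' : (0 : ℝ) < r := by exact_mod_cast hr
  have hv' : (0 : ℝ) < v := by exact_mod_cast hv
  have hUa' : (0 : ℝ) < Ua := by exact_mod_cast hUa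
  have hUb' : (0 : ℝ) < Ub := by exact_mod_cast hUb
  have hUc' : (0 : ℝ) < Uc := by exact_mod_cast hUc
  have ha' : (0 : ℝ) < a := by exact_mod_cast ha
  have hb' : (0 : ℝ) < b := by exact_mod_cast hb
  have hc' : (0 : ℝ) < c := by exact_mod_cast hc
  have hcd' : (0 : ℝ) < cd := by exact_mod_cast hcd
  have h2 : 0 < Real.log 2 := Real.log_pos one_lt_two
  have h' : (v : ℝ) ^ cn * ((Ua : ℝ) * Ub * Uc) ^ cd ≤ (r : ℝ) ^ (3 * cd) * ((a : ℝ) * b * c) ^ cd := by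
    exact_mod_cast h
  have hl := Real.log_le_log (by positivity) h'
  have eL : Real.log ((v : ℝ) ^ cn * ((Ua : ℝ) * Ub * Uc) ^ cd) =
      cn * Real.log v + cd * (Real.log Ua + Real.log Ub + Real.log Uc) := by
    rw [Real.log_mul (pow_ne_zero _ hv'.ne')
        (pow_ne_zero _ (mul_ne_zero (mul_ne_zero hUa'.ne' hUb'.ne') hUc'.ne')),
      Real.log_pow, Real.log_pow, Real.log_mul (mul_ne_zero hUa'.ne' hUb'.ne') hUc'.ne',
      Real.log_mul hUa'.ne' hUb'.ne']
  have eR : Real.log ((r : ℝ) ^ (3 * cd) * ((a : ℝ) * b * c) ^ cd) =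
      3 * cd * Real.log r + cd * (Real.log a + Real.log b + Real.log c) := by
    rw [Real.log_mul (pow_ne_zero _ hr'.ne')
        (pow_ne_zero _ (mul_ne_zero (mul_ne_zero ha'.ne' hb'.ne') hc'.ne')),
      Real.log_pow, Real.log_pow, Real.log_mul (mul_ne_zero ha'.ne' hb'.ne') hc'.ne',
      Real.log_mul ha'.ne' hb'.ne']
    push_cast
    ring
  rw [eL, eR] at hl
  rw [Real.log_div ha'.ne' hUa'.ne', Real.log_div hb'.ne' hUb'.ne', Real.log_div hc'.ne' hUc'.ne']
  simp only [Real.logb]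
  rw [← sub_nonneg]
  have e : Real.log r / Real.log 2 -
      ((1 / 3 : ℝ) * (-(Real.log a - Real.log Ua) / Real.log 2) +
          1 / 3 * (-(Real.log b - Real.log Ub) / Real.log 2) +
          1 / 3 * (-(Real.log c - Real.log Uc) / Real.log 2) +
        (cn : ℝ) / cd * (Real.log v / Real.log 2) / 3) =
      (3 * cd * Real.log r + cd * (Real.log a + Real.log b + Real.log c) -
        (cn * Real.log v + cd * (Real.log Ua + Real.log Ub + Real.log Uc))) / (3 * cd * Real.log 2) := by
    field_simp
    ring
  rw [e]
  exact div_nonneg (by linarith) (by positivity)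

/-- **Soundness of the break-even certificate.**  If `check cn cd` passes then the structure cannot
prove `ω < ρ` for any `ρ ≤ cn/cd`: Gibbs' inequality (`weightedEntropy_le_sum_mul_score`, weights
`1/3`) with the certified duals `Q_m = q_m/Q_m`, then the pointwise inequalities `point_ineq` averaged
against `P`; monotonicity in `ρ` because `log₂ vol ≥ 0`. [cite: BurgisserClausenShokrollahi1997, Thm. 15.41 (p. 380)] -/
theorem cannotBeat_of_check {C : LaserCert} {cn cd : ℕ} (h : C.check cn cd = true) {ρ : ℝ}
    (hρ : ρ ≤ (cn : ℝ) / cd) : C.CannotBeat ρ := by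
  simp only [check, Bool.and_eq_true, decide_eq_true_eq, List.all_eq_true] at h
  obtain ⟨⟨⟨⟨⟨⟨⟨⟨hcd, hr⟩, hQa⟩, hQb⟩, hQc⟩, hsa⟩, hsb⟩, hsc⟩, hall⟩ := h
  intro P hP0 hP1 hPS
  have hQa' : (0 : ℝ) < C.Qa := by exact_mod_cast hQa
  have hQb' : (0 : ℝ) < C.Qb := by exact_mod_cast hQb
  have hQc' : (0 : ℝ) < C.Qc := by exact_mod_cast hQc
  -- the listed point behind a block index carrying mass
  have hmem : ∀ y, P y ≠ 0 → ∃ p ∈ C.pts,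
      C.pts.find? (fun p => decide (ptKey p = C.key y)) = some p ∧ ptKey p = C.key y := by
    intro y hy
    have hyS : y ∈ C.support := by
      by_contra h'
      exact hy (hPS y h')
    obtain ⟨p, hp, hpk⟩ := hyS
    have hsome : (C.pts.find? (fun p => decide (ptKey p = C.key y))).isSome := by
      rw [List.find?_isSome]
      exact ⟨p, hp, by simpa using hpk⟩
    obtain ⟨p', hp'⟩ := Option.isSome_iff_exists.mp hsome
    refine ⟨p', List.mem_of_find?_eq_some hp', hp', ?_⟩
    simpa using List.find?_some hp'
  -- Gibbs' inequality with the certified duals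
  have hsum₁ : ∑ a : Fin C.na, (C.qa.getD a.val 0 : ℝ) / C.Qa ≤ 1 := by
    rw [← Finset.sum_div, div_le_one hQa']
    rw [sumBelow_eq] at hsa
    exact_mod_cast hsa
  have hsum₂ : ∑ b : Fin C.nb, (C.qb.getD b.val 0 : ℝ) / C.Qb ≤ 1 := by
    rw [← Finset.sum_div, div_le_one hQb']
    rw [sumBelow_eq] at hsb
    exact_mod_cast hsb
  have hsum₃ : ∑ c : Fin C.nc, (C.qc.getD c.val 0 : ℝ) / C.Qc ≤ 1 := by
    rw [← Finset.sum_div, div_le_one hQc']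
    rw [sumBelow_eq] at hsc
    exact_mod_cast hsc
  have hG : (1 / 3 : ℝ) * shannonEntropy (marginalDist₁ P) + 1 / 3 * shannonEntropy (marginalDist₂ P) +
      1 / 3 * shannonEntropy (marginalDist₃ P) ≤
      ∑ y, P y * ((1 / 3 : ℝ) * (-Real.log ((C.qa.getD y.1.val 0 : ℝ) / C.Qa) / Real.log 2) +
        1 / 3 * (-Real.log ((C.qb.getD y.2.1.val 0 : ℝ) / C.Qb) / Real.log 2) +
        1 / 3 * (-Real.log ((C.qc.getD y.2.2.val 0 : ℝ) / C.Qc) / Real.log 2)) := by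
    have := weightedEntropy_le_sum_mul_score (θ := fun _ => (1 / 3 : ℝ)) (fun _ => by norm_num)
      (P := P) ⟨hP0, hP1⟩ (Q₁ := fun a => (C.qa.getD a.val 0 : ℝ) / C.Qa)
      (Q₂ := fun b => (C.qb.getD b.val 0 : ℝ) / C.Qb) (Q₃ := fun c => (C.qc.getD c.val 0 : ℝ) / C.Qc)
      (fun a => by positivity) hsum₁ (fun b => by positivity) hsum₂ (fun c => by positivity) hsum₃
      (by
        intro y hy
        obtain ⟨p, hp, -, hk⟩ := hmem y hy
        have hc := hall p hp
        simp only [pointCheck, Bool.and_eq_true, decide_eq_true_eq] at hc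
        obtain ⟨⟨⟨⟨-, ha⟩, hb⟩, hcq⟩, -⟩ := hc
        simp only [ptKey, key, Prod.mk.injEq] at hk
        obtain ⟨hk1, hk2, hk3⟩ := hk
        refine ⟨fun _ => ?_, fun _ => ?_, fun _ => ?_⟩
        · have : (0 : ℝ) < C.qa.getD y.1.val 0 := by rw [← hk1]; exact_mod_cast ha
          positivity
        · have : (0 : ℝ) < C.qb.getD y.2.1.val 0 := by rw [← hk2]; exact_mod_cast hb
          positivity
        · have : (0 : ℝ) < C.qc.getD y.2.2.val 0 := by rw [← hk3]; exact_mod_cast hcq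
          positivity)
    simpa [weightedEntropy] using this
  -- the pointwise inequalities, weighted by `P`
  have hpt : ∀ y, P y * ((1 / 3 : ℝ) * (-Real.log ((C.qa.getD y.1.val 0 : ℝ) / C.Qa) / Real.log 2) +
        1 / 3 * (-Real.log ((C.qb.getD y.2.1.val 0 : ℝ) / C.Qb) / Real.log 2) +
        1 / 3 * (-Real.log ((C.qc.getD y.2.2.val 0 : ℝ) / C.Qc) / Real.log 2)) +
      ρ * (P y * Real.logb 2 (C.vol y : ℝ)) / 3 ≤ P y * Real.logb 2 (C.r : ℝ) := by
    intro y
    by_cases hy : P y = 0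
    · simp [hy]
    obtain ⟨p, hp, hfind, hk⟩ := hmem y hy
    have hc := hall p hp
    simp only [pointCheck, Bool.and_eq_true, decide_eq_true_eq] at hc
    obtain ⟨⟨⟨⟨hv, ha⟩, hb⟩, hcq⟩, hineq⟩ := hc
    simp only [ptKey, key, Prod.mk.injEq] at hk
    obtain ⟨hk1, hk2, hk3⟩ := hk
    have hvol : C.vol y = p.2.2.2 := by
      simp only [vol, hfind]
    have hPy : 0 < P y := lt_of_le_of_ne (hP0 y) (Ne.symm hy)
    have key := point_ineq hcd hr hv hQa hQb hQc ha hb hcq hineq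
    rw [hk1, hk2, hk3] at key
    have hlogv : 0 ≤ Real.logb 2 (p.2.2.2 : ℝ) :=
      Real.logb_nonneg one_lt_two (by exact_mod_cast hv)
    have hρv : ρ * Real.logb 2 (p.2.2.2 : ℝ) ≤ (cn : ℝ) / cd * Real.logb 2 (p.2.2.2 : ℝ) :=
      mul_le_mul_of_nonneg_right hρ hlogv
    rw [hvol]
    have step : (1 / 3 : ℝ) * (-Real.log ((C.qa.getD y.1.val 0 : ℝ) / C.Qa) / Real.log 2) +
          1 / 3 * (-Real.log ((C.qb.getD y.2.1.val 0 : ℝ) / C.Qb) / Real.log 2) +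
          1 / 3 * (-Real.log ((C.qc.getD y.2.2.val 0 : ℝ) / C.Qc) / Real.log 2) +
        ρ * Real.logb 2 (p.2.2.2 : ℝ) / 3 ≤ Real.logb 2 (C.r : ℝ) := by
      linarith
    have := mul_le_mul_of_nonneg_left step hPy.le
    linarith [this]
  have e1 : ∑ y, P y * Real.logb 2 (C.r : ℝ) = Real.logb 2 (C.r : ℝ) := by
    rw [← Finset.sum_mul, hP1, one_mul]
  have e2 : ∑ y, ρ * (P y * Real.logb 2 (C.vol y : ℝ)) / 3 =
      ρ * (∑ y, P y * Real.logb 2 (C.vol y : ℝ)) / 3 := by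
    rw [Finset.mul_sum, Finset.sum_div]
  have hS := Finset.sum_le_sum fun y (_ : y ∈ (Finset.univ : Finset C.Idx)) => hpt y
  rw [Finset.sum_add_distrib, e1, e2] at hS
  unfold laserFunctional
  linarith [hG, hS]

/-- `cannotBeat_of_check` at the exponent `12/5` used by the bundle's tables. [folklore] -/
theorem cannotBeat_of_check_12_5 {C : LaserCert} (h : C.check 12 5 = true) {ρ : ℝ}
    (hρ : ρ ≤ 12 / 5) : C.CannotBeat ρ :=
  cannotBeat_of_check h (by norm_num; exact hρ)

/-! ## Readings of `CannotBeat` -/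

/-- The `min`-form: with `min_m H(P_m)` (the left side of BCS (15.41) verbatim, `ω` replaced by `ρ`)
in place of the average. [cite: BurgisserClausenShokrollahi1997, Thm. 15.41 (p. 380)] -/
theorem CannotBeat.min_form {C : LaserCert} {ρ : ℝ} (h : C.CannotBeat ρ) (P : C.Idx → ℝ)
    (hP0 : ∀ y, 0 ≤ P y) (hP1 : ∑ y, P y = 1) (hPS : ∀ y, y ∉ C.support → P y = 0) :
    min (shannonEntropy (marginalDist₁ P))
        (min (shannonEntropy (marginalDist₂ P)) (shannonEntropy (marginalDist₃ P))) +
      ρ * (∑ y, P y * Real.logb 2 (C.vol y : ℝ)) / 3 ≤ Real.logb 2 (C.r : ℝ) := by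
  have h1 := h P hP0 hP1 hPS
  unfold laserFunctional at h1
  have m1 := min_le_left (shannonEntropy (marginalDist₁ P))
    (min (shannonEntropy (marginalDist₂ P)) (shannonEntropy (marginalDist₃ P)))
  have m2 := le_trans (min_le_right (shannonEntropy (marginalDist₁ P))
    (min (shannonEntropy (marginalDist₂ P)) (shannonEntropy (marginalDist₃ P))))
    (min_le_left _ _)
  have m3 := le_trans (min_le_right (shannonEntropy (marginalDist₁ P))
    (min (shannonEntropy (marginalDist₂ P)) (shannonEntropy (marginalDist₃ P))))
    (min_le_right _ _)
  linarith

/-- **What the certificate says about extracted bounds.**  For every distribution `P` on `S` with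
`E_P log₂ vol > 0` and every cost `R` with `log₂ R = L ≥ log₂ r`, the exponent bound the structure
extracts from the symmetrised (15.41), `3 (L − H̄(P)) / E_P log₂ vol`, is at least `ρ`.
[cite: BurgisserClausenShokrollahi1997, Thm. 15.41 and (15.43) (pp. 380–383)] -/
theorem CannotBeat.le_extracted_bound {C : LaserCert} {ρ : ℝ} (h : C.CannotBeat ρ) (P : C.Idx → ℝ)
    (hP0 : ∀ y, 0 ≤ P y) (hP1 : ∑ y, P y = 1) (hPS : ∀ y, y ∉ C.support → P y = 0) {L : ℝ}
    (hL : Real.logb 2 (C.r : ℝ) ≤ L) (hE : 0 < ∑ y, P y * Real.logb 2 (C.vol y : ℝ)) :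
    ρ ≤ 3 * (L - (shannonEntropy (marginalDist₁ P) + shannonEntropy (marginalDist₂ P) +
        shannonEntropy (marginalDist₃ P)) / 3) / ∑ y, P y * Real.logb 2 (C.vol y : ℝ) := by
  have h1 := h P hP0 hP1 hPS
  unfold laserFunctional at h1
  rw [le_div_iff₀ hE]
  nlinarith

/-! ## Worked instance: the big Coppersmith–Winograd tensor `CW_3` -/

/-- `CW_3` (`q = 3`, format `5 × 5 × 5`, `R̲ = 5`): its unique admissible structure
`D = {0}{1,2,3}{4}` in each factor — block support `{(0,1,1),(1,0,1),(1,1,0)}` (volumes `3`: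
`⟨1,1,3⟩` and its rotations) `∪ {(0,0,2),(0,2,0),(2,0,0)}` (volumes `1`) — with the integer dual
`Q = (5,8,1)/14` on each factor (bundle `numerics/gen9/breakeven24.py`; value of the structure
`2.4739043…`, CW 1990 §6 with `q = 3`). [cite: CoppersmithWinograd1990, §6] -/
def cert_CW3 : LaserCert :=
  ⟨3, 3, 3, [(0, 0, 2, 1), (0, 1, 1, 3), (0, 2, 0, 1), (1, 0, 1, 3), (1, 1, 0, 3), (2, 0, 0, 1)], 5,
    [5, 8, 1], [5, 8, 1], [5, 8, 1], 14, 14, 14⟩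

/-- Kernel check of the `CW_3` certificate at `ρ = 12/5`. [folklore] -/
theorem check_CW3 : cert_CW3.check 12 5 = true := by
  decide +kernel

/-- **`CW_3` at level 1 cannot prove `ω < 12/5`** (its value is `2.4739…`; certified here: `≥ 2.4`).
[cite: CoppersmithWinograd1990, §6] -/
theorem cannotBeat_CW3 {ρ : ℝ} (hρ : ρ ≤ 12 / 5) : cert_CW3.CannotBeat ρ :=
  cannotBeat_of_check_12_5 check_CW3 hρ

end LaserCert

end Literature.Computability.AlgebraicComplexity
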